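import Literature.NumberTheory.GaussSums.JacobiSumTeichmullerPadicProofs
import Mathlib.NumberTheory.Padics.Complex
import HarnessLib

/-!
# The `p`-adic absolute value of the Gauss sum of a Teichmüller power of exponent `(p−1)/e` or
# `(e−1)(p−1)/e` (Stickelberger's theorem, Lang Ch. 1 §2 Thm. 2.1, the case `q = p`, in `ℂ_p`)

Topic `Literature/NumberTheory/GaussSums`. `Proofs` file: theorems only, no definition, no named
fact (net debt 0). Companion of `JacobiSumTeichmullerPadicProofs.lean` (the `p`-adic norms of the
Jacobi sums of Teichmüller powers) and of `StickelbergerCongruence.lean` (Lang's Thm. 2.1 in the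
abstract residue-ring form). Here: for a `ℚ_p`-valued character `χ = ω^t` of `(ℤ/p)^×` of order
`e ≥ 2` and ANY primitive additive character `ψ` of `ℤ/p` with values in `ℂ_p`,

* `norm_gaussSum_pow_of_mul_eq` — if `t·e = p − 1` (the SMALLEST exponent of order `e`):
  `‖G(ι∘χ, ψ)‖^e = p^{−(e−1)}`, i.e. `ord_p G(ω^t) = 1 − 1/e = 1 − t/(p−1)`;
* `norm_gaussSum_pow_of_mul_eq'` — if `t·e = (e−1)(p−1)` (the LARGEST): `‖G(ι∘χ, ψ)‖^e = p⁻¹`,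
  i.e. `ord_p G(ω^t) = 1/e = 1 − t/(p−1)`;

both instances of Stickelberger's `ord_p G(ω^{−a}) = a/(p−1)` (Lang Thm. 2.1 with `q = p`,
`s(a) = a`), proved through `G(χ)^e = χ(−1)·p·∏_{j=1}^{e−2} J(χ, χ^j)` (Mathlib
`gaussSum_pow_eq_prod_jacobiSum`) and the Jacobi-sum norms: in the first case every
`J(ω^t, ω^{jt})` has norm `p⁻¹` (`t + jt < p − 1`), in the second every `J` is a unit. These two
exponents are exactly the ones met by the characters of order `e ∈ {3, 4, 6}` through which inertia
acts at an additive, potentially good ordinary prime (cell `b2b-bsdres`, sub-cell additive-p2: the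
intrinsic Gauss sums `τ(ε, ψ_κ)` of the tame-branch interpolation have `‖τ(ε,ψ_κ)‖ = ‖G(ε, ψ)‖`,
`Summit.….norm_tameGaussSum_eq_norm_gaussSum`; the two conjugate characters `ω^{±t}` have Gauss sums
of DIFFERENT absolute value `p^{−(1−1/e)} ≠ p^{−1/e}` — the arithmetic behind a character-free sign
certificate).

## References
* S. Lang, *Cyclotomic Fields I and II*, GTM 121 (1990), Ch. 1 §2 Thm. 2.1 (`ord_𝔓 S(ω^{−k}) = s(k)`),
  §1 GS 2–GS 3. [Lang1990]
* K. Ireland, M. Rosen, GTM 84, Ch. 8 §3–§5 (Gauss and Jacobi sums, `g(χ)^e` via Jacobi sums).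
  [IrelandRosen1990]
-/

noncomputable section

open scoped Classical
open Finset

namespace Literature.NumberTheory.GaussSums

section GaussTeichmuller

variable {p : ℕ} [hp : Fact p.Prime]

/-- Values of a `ℚ_p`-valued character of `(ℤ/p)^×` at units have norm `1`. [folklore] -/
private theorem norm_mulChar_apply_eq_one' (χ : MulChar (ZMod p) ℚ_[p]) {a : ZMod p} (ha : a ≠ 0) :
    ‖χ a‖ = 1 := by
  have h1 : (χ a) ^ (p - 1) = 1 := by
    rw [← map_pow, ZMod.pow_card_sub_one_eq_one ha, map_one]
  have h2 : ‖χ a‖ ^ (p - 1) = 1 := by rw [← norm_pow, h1, norm_one]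
  have hp1 : p - 1 ≠ 0 := by have := hp.out.two_le; omega
  exact (pow_eq_one_iff_of_nonneg (norm_nonneg _) hp1).mp h2

/-- The `ℂ_p`-copy `ι ∘ χ` has the same order as `χ`. [folklore] -/
private theorem orderOf_ringHomComp_padicComplex (χ : MulChar (ZMod p) ℚ_[p]) :
    orderOf (χ.ringHomComp (algebraMap ℚ_[p] ℂ_[p])) = orderOf χ := by
  rw [orderOf_eq_orderOf_iff]
  intro n
  rw [MulChar.ringHomComp_pow, MulChar.ringHomComp_eq_one_iff (algebraMap ℚ_[p] ℂ_[p]).injective]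

/-- `‖â^n − â^m‖_p < 1` for a unit residue `a` when `n ≡ m (mod p−1)` with `n = m + k(p−1)`
(Fermat: `a^{p−1} ≡ 1`). [folklore] -/
private theorem norm_natCast_pow_sub_pow_lt_one {a : ZMod p} (ha : a ≠ 0) (m k : ℕ) :
    ‖((a.val : ℕ) : ℚ_[p]) ^ (m + k * (p - 1)) - ((a.val : ℕ) : ℚ_[p]) ^ m‖ < 1 := by
  have hF : ‖((a.val : ℕ) : ℚ_[p]) ^ (p - 1) - 1‖ < 1 := by
    have hdvd : (p : ℤ) ∣ ((a.val : ℤ) ^ (p - 1) - 1) := by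
      have h0 : (((a.val : ℤ) ^ (p - 1) - 1 : ℤ) : ZMod p) = 0 := by
        push_cast
        rw [ZMod.natCast_zmod_val, ZMod.pow_card_sub_one_eq_one ha, sub_self]
      exact (ZMod.intCast_zmod_eq_zero_iff_dvd _ p).mp h0
    have := Padic.norm_intCast_lt_one_iff.mpr hdvd
    push_cast at this
    exact this
  have hle : ‖((a.val : ℕ) : ℚ_[p]) ^ m‖ ≤ 1 := by
    rw [norm_pow]
    refine pow_le_one₀ (norm_nonneg _) ?_
    exact_mod_cast Padic.norm_int_le_one (p := p) (a.val : ℤ)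
  have hle' : ∀ j : ℕ, ‖(((a.val : ℕ) : ℚ_[p]) ^ (p - 1)) ^ j - 1‖ < 1 := by
    intro j
    induction j with
    | zero => simp
    | succ j ih =>
      have hsplit : (((a.val : ℕ) : ℚ_[p]) ^ (p - 1)) ^ (j + 1) - 1 =
          (((a.val : ℕ) : ℚ_[p]) ^ (p - 1)) ^ j * (((a.val : ℕ) : ℚ_[p]) ^ (p - 1) - 1) +
            ((((a.val : ℕ) : ℚ_[p]) ^ (p - 1)) ^ j - 1) := by ring
      rw [hsplit]
      refine (IsUltrametricDist.norm_add_le_max _ _).trans_lt (max_lt ?_ ih)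
      rw [norm_mul]
      have hj : ‖(((a.val : ℕ) : ℚ_[p]) ^ (p - 1)) ^ j‖ ≤ 1 := by
        rw [← pow_mul, norm_pow]
        refine pow_le_one₀ (norm_nonneg _) ?_
        exact_mod_cast Padic.norm_int_le_one (p := p) (a.val : ℤ)
      calc ‖(((a.val : ℕ) : ℚ_[p]) ^ (p - 1)) ^ j‖ * ‖((a.val : ℕ) : ℚ_[p]) ^ (p - 1) - 1‖
          ≤ 1 * ‖((a.val : ℕ) : ℚ_[p]) ^ (p - 1) - 1‖ := by gcongr
        _ < 1 := by rw [one_mul]; exact hF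
  have hsplit : ((a.val : ℕ) : ℚ_[p]) ^ (m + k * (p - 1)) - ((a.val : ℕ) : ℚ_[p]) ^ m =
      ((a.val : ℕ) : ℚ_[p]) ^ m * ((((a.val : ℕ) : ℚ_[p]) ^ (p - 1)) ^ k - 1) := by
    rw [pow_add, mul_comm k, pow_mul]; ring
  rw [hsplit, norm_mul]
  calc ‖((a.val : ℕ) : ℚ_[p]) ^ m‖ * ‖(((a.val : ℕ) : ℚ_[p]) ^ (p - 1)) ^ k - 1‖
      ≤ 1 * ‖(((a.val : ℕ) : ℚ_[p]) ^ (p - 1)) ^ k - 1‖ := by gcongr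
    _ < 1 := by rw [one_mul]; exact hle' k

/-- A power of a Teichmüller power is a Teichmüller power: `‖χ^j(a) − â^{jt}‖_p < 1`. [folklore] -/
private theorem norm_pow_apply_sub_pow_lt_one {χ : MulChar (ZMod p) ℚ_[p]} {t : ℕ}
    (hχ : ∀ a : ZMod p, a ≠ 0 → ‖χ a - ((a.val : ℕ) : ℚ_[p]) ^ t‖ < 1) (j : ℕ) {a : ZMod p}
    (ha : a ≠ 0) : ‖(χ ^ j) a - ((a.val : ℕ) : ℚ_[p]) ^ (j * t)‖ < 1 := by
  obtain ⟨u, hu⟩ := Ne.isUnit ha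
  have hpow : (χ ^ j) a = (χ a) ^ j := by rw [← hu, MulChar.pow_apply_coe]
  rw [hpow, pow_mul']
  -- `x^j − y^j = (Σ x^i y^{j−1−i})·(x − y)` with all factors of norm ≤ 1
  set x := χ a
  set y := ((a.val : ℕ) : ℚ_[p]) ^ t
  have hx : ‖x‖ ≤ 1 := by
    have h1 : x ^ (p - 1) = 1 := by
      rw [← map_pow, ZMod.pow_card_sub_one_eq_one ha, map_one]
    have h2 : ‖x‖ ^ (p - 1) = 1 := by rw [← norm_pow, h1, norm_one]
    have hp1 : p - 1 ≠ 0 := by have := hp.out.two_le; omega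
    exact ((pow_eq_one_iff_of_nonneg (norm_nonneg _) hp1).mp h2).le
  have hy : ‖y‖ ≤ 1 := by
    rw [norm_pow]
    refine pow_le_one₀ (norm_nonneg _) ?_
    exact_mod_cast Padic.norm_int_le_one (p := p) (a.val : ℤ)
  rw [← (Commute.all x y).geom_sum₂_mul, norm_mul]
  have hS : ‖∑ i ∈ range j, x ^ i * y ^ (j - 1 - i)‖ ≤ 1 := by
    by_cases hj : j = 0
    · subst hj; simp
    obtain ⟨i₀, -, hi₀⟩ := IsUltrametricDist.exists_norm_finsetSum_le_of_nonempty
      (Finset.nonempty_range_iff.mpr hj) (fun i ↦ x ^ i * y ^ (j - 1 - i))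
    refine hi₀.trans ?_
    rw [norm_mul, norm_pow, norm_pow]
    exact mul_le_one₀ (pow_le_one₀ (norm_nonneg _) hx) (by positivity)
      (pow_le_one₀ (norm_nonneg _) hy)
  calc ‖∑ i ∈ range j, x ^ i * y ^ (j - 1 - i)‖ * ‖x - y‖ ≤ 1 * ‖x - y‖ := by gcongr
    _ < 1 := by rw [one_mul]; exact hχ a ha


/-- Norm of the image of `p` in `ℂ_p`. [folklore] -/
private theorem norm_natCast_padicComplex_prime : ‖((p : ℕ) : ℂ_[p])‖ = (p : ℝ)⁻¹ := by
  rw [← map_natCast (algebraMap ℚ_[p] ℂ_[p]) p, norm_algebraMap', Padic.norm_p]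

/-- **Stickelberger, smallest exponent: `‖G(ω^u, ψ)‖^e = p^{−(e−1)}` for `eu = p − 1`.** Let
`χ : (ℤ/p)^× → ℚ_p` be a Teichmüller power of exponent `u` (`‖χ(a) − a^u‖_p < 1`) of order `e ≥ 2`
with `e·u = p − 1`, and `ψ` a primitive additive character of `ℤ/p` with values in `ℂ_p`. Then
`‖G(ι∘χ, ψ)‖^e = (p⁻¹)^{e−1}`, i.e. `ord_p G = 1 − 1/e`: by `G^e = χ(−1)·p·∏_{j=1}^{e−2} J(χ, χ^j)`
and `‖J(ω^u, ω^{ju})‖ = p⁻¹` (`u + ju < p − 1`). (Lang Thm. 2.1 with `q = p`: `ord G(ω^{−a}) = a/(p−1)`,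
here `a = p − 1 − u`.) [cite: Lang1990, Ch. 1 §2 Thm. 2.1] [cite: IrelandRosen1990, Ch. 8 §5 (g(χ)^e via Jacobi sums)] -/
theorem norm_gaussSum_pow_eq_of_mul_eq {χ : MulChar (ZMod p) ℚ_[p]} {u e : ℕ}
    (hχ : ∀ a : ZMod p, a ≠ 0 → ‖χ a - ((a.val : ℕ) : ℚ_[p]) ^ u‖ < 1)
    (he : orderOf χ = e) (h2 : 2 ≤ e) (hu : e * u = p - 1)
    {ψ : AddChar (ZMod p) ℂ_[p]} (hψ : ψ.IsPrimitive) :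
    ‖gaussSum (χ.ringHomComp (algebraMap ℚ_[p] ℂ_[p])) ψ‖ ^ e = ((p : ℝ)⁻¹) ^ (e - 1) := by
  have hp2 := hp.out.two_le
  set ι := algebraMap ℚ_[p] ℂ_[p] with hι
  have hord : orderOf (χ.ringHomComp ι) = e := by rw [orderOf_ringHomComp_padicComplex, he]
  have hG := gaussSum_pow_eq_prod_jacobiSum (χ := χ.ringHomComp ι) (ψ := ψ) (by rw [hord]; exact h2)
    hψ
  rw [hord, ZMod.card] at hG
  have hu1 : 1 ≤ u := by
    rcases Nat.eq_zero_or_pos u with h | h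
    · rw [h, mul_zero] at hu; omega
    · exact h
  have hχ1 : χ ≠ 1 := by
    intro h; rw [h, orderOf_one] at he; omega
  -- the Jacobi sums
  have hJ : ∀ i ∈ Ico 1 (e - 1),
      ‖jacobiSum (χ.ringHomComp ι) ((χ.ringHomComp ι) ^ i)‖ = (p : ℝ)⁻¹ := by
    intro i hi
    rw [Finset.mem_Ico] at hi
    rw [MulChar.ringHomComp_pow, jacobiSum_ringHomComp, hι, norm_algebraMap']
    have hi1 : 1 ≤ i * u := Nat.one_le_iff_ne_zero.mpr (Nat.mul_ne_zero (by omega) (by omega))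
    have hsum : u + i * u < p - 1 := by
      rw [← hu]
      have h1 : (1 + i) * u ≤ (e - 1) * u := Nat.mul_le_mul_right _ (by omega)
      have h2 : (e - 1) * u < e * u := Nat.mul_lt_mul_of_pos_right (by omega) hu1
      nlinarith
    refine norm_jacobiSum_eq_inv_of_add_lt hu1 hi1 hsum hχ
      (fun a ha ↦ norm_pow_apply_sub_pow_lt_one hχ i ha) hχ1 ?_ ?_
    · exact pow_ne_one_of_lt_orderOf (by omega) (by rw [he]; omega)
    · rw [← pow_succ']
      exact pow_ne_one_of_lt_orderOf (by omega) (by rw [he]; omega)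
  -- norms
  have hn := congrArg (‖·‖) hG
  simp only [norm_pow, norm_mul] at hn
  rw [norm_prod, Finset.prod_congr rfl hJ, Finset.prod_const, Nat.card_Ico,
    MulChar.ringHomComp_apply, hι, norm_algebraMap', norm_natCast_padicComplex_prime,
    norm_mulChar_apply_eq_one' χ (neg_ne_zero.mpr one_ne_zero), one_mul] at hn
  rw [hn, ← pow_succ']
  congr 1
  omega

/-- **Stickelberger, largest exponent: `‖G(ω^{(e−1)u}, ψ)‖^e = p⁻¹` for `eu = p − 1`.** Let
`χ : (ℤ/p)^× → ℚ_p` be a Teichmüller power of exponent `(e−1)u` of order `e ≥ 2` with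
`e·u = p − 1`, `ψ` primitive. Then `‖G(ι∘χ, ψ)‖^e = p⁻¹`, i.e. `ord_p G = 1/e`: every Jacobi sum
`J(χ, χ^j)`, `1 ≤ j ≤ e − 2`, is a `p`-adic UNIT (`χ^j = ω^{(e−j)u}`, `(e−1)u + (e−j)u > p − 1`).
Together with `norm_gaussSum_pow_eq_of_mul_eq`: the two conjugate characters of order
`e ∈ {3, 4, 6}` have Gauss sums of DIFFERENT `p`-adic absolute value.
[cite: Lang1990, Ch. 1 §2 Thm. 2.1] [cite: IrelandRosen1990, Ch. 8 §5 (g(χ)^e via Jacobi sums)] -/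
theorem norm_gaussSum_pow_eq_of_mul_eq' {χ : MulChar (ZMod p) ℚ_[p]} {u e : ℕ}
    (hχ : ∀ a : ZMod p, a ≠ 0 → ‖χ a - ((a.val : ℕ) : ℚ_[p]) ^ ((e - 1) * u)‖ < 1)
    (he : orderOf χ = e) (h2 : 2 ≤ e) (hu : e * u = p - 1)
    {ψ : AddChar (ZMod p) ℂ_[p]} (hψ : ψ.IsPrimitive) :
    ‖gaussSum (χ.ringHomComp (algebraMap ℚ_[p] ℂ_[p])) ψ‖ ^ e = (p : ℝ)⁻¹ := by
  have hp2 := hp.out.two_le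
  set ι := algebraMap ℚ_[p] ℂ_[p] with hι
  have hord : orderOf (χ.ringHomComp ι) = e := by rw [orderOf_ringHomComp_padicComplex, he]
  have hG := gaussSum_pow_eq_prod_jacobiSum (χ := χ.ringHomComp ι) (ψ := ψ) (by rw [hord]; exact h2)
    hψ
  rw [hord, ZMod.card] at hG
  have hu1 : 1 ≤ u := by
    rcases Nat.eq_zero_or_pos u with h | h
    · rw [h, mul_zero] at hu; omega
    · exact h
  -- the Jacobi sums are units
  have hJ : ∀ i ∈ Ico 1 (e - 1),
      ‖jacobiSum (χ.ringHomComp ι) ((χ.ringHomComp ι) ^ i)‖ = 1 := by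
    intro i hi
    rw [Finset.mem_Ico] at hi
    rw [MulChar.ringHomComp_pow, jacobiSum_ringHomComp, hι, norm_algebraMap']
    -- `χ^i` is the Teichmüller power of exponent `(e − i)u`
    have hexp : i * ((e - 1) * u) = (e - i) * u + (i - 1) * (p - 1) := by
      rw [← hu]
      have hie : i ≤ e := by omega
      have hi1 : 1 ≤ i := hi.1
      zify [hie, hi1, (by omega : 1 ≤ e)]
      ring
    have hχi : ∀ a : ZMod p, a ≠ 0 → ‖(χ ^ i) a - ((a.val : ℕ) : ℚ_[p]) ^ ((e - i) * u)‖ < 1 := by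
      intro a ha
      have h1 := norm_pow_apply_sub_pow_lt_one hχ i ha
      rw [hexp] at h1
      have h2 := norm_natCast_pow_sub_pow_lt_one ha ((e - i) * u) (i - 1)
      calc ‖(χ ^ i) a - ((a.val : ℕ) : ℚ_[p]) ^ ((e - i) * u)‖
          = ‖((χ ^ i) a - ((a.val : ℕ) : ℚ_[p]) ^ ((e - i) * u + (i - 1) * (p - 1))) +
              (((a.val : ℕ) : ℚ_[p]) ^ ((e - i) * u + (i - 1) * (p - 1)) -
                ((a.val : ℕ) : ℚ_[p]) ^ ((e - i) * u))‖ := by rw [sub_add_sub_cancel]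
        _ ≤ max _ _ := IsUltrametricDist.norm_add_le_max _ _
        _ < 1 := max_lt h1 h2
    have ht1 : (e - 1) * u ≤ p - 2 := by
      rw [show p - 2 = p - 1 - 1 by omega, ← hu]
      have : (e - 1) * u + u = e * u := by
        rw [← Nat.succ_mul]; congr 1; omega
      omega
    have ht2 : (e - i) * u ≤ p - 2 := by
      rw [show p - 2 = p - 1 - 1 by omega, ← hu]
      have h1 : (e - i) * u ≤ (e - 1) * u := Nat.mul_le_mul_right _ (by omega)
      have : (e - 1) * u + u = e * u := by
        rw [← Nat.succ_mul]; congr 1; omega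
      omega
    have hsum : p - 1 < (e - 1) * u + (e - i) * u := by
      rw [← hu, ← Nat.add_mul]
      exact Nat.mul_lt_mul_of_pos_right (by omega) hu1
    exact norm_jacobiSum_eq_one_of_lt_add ht1 ht2 hsum hχ hχi
  -- norms
  have hn := congrArg (‖·‖) hG
  simp only [norm_pow, norm_mul] at hn
  rw [norm_prod, Finset.prod_congr rfl hJ, Finset.prod_const_one,
    MulChar.ringHomComp_apply, hι, norm_algebraMap', norm_natCast_padicComplex_prime,
    norm_mulChar_apply_eq_one' χ (neg_ne_zero.mpr one_ne_zero), one_mul, mul_one] at hn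
  exact hn

end GaussTeichmuller

end Literature.NumberTheory.GaussSums

end
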